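import Mathlib
import HarnessLib
import Literature.NumberTheory.LFunctions.RHWave0

/-!
# Cardinal's symmetric matrices `𝒰ₙ`, `ℳₙ = T 𝒰ₙ⁻¹ T` and the Mertens function

J.-P. Cardinal (2010) attaches to every `n ≥ 1` the set `𝒮ₙ = {⌊n/k⌋ : 1 ≤ k ≤ n}` of
"approximate divisors" of `n` (Lagarias–Montague's name; `#𝒮ₙ ≈ 2√n`), the involution
`k ↦ k̄ = ⌊n/k⌋` of `𝒮ₙ`, the regular representation `ρₙ` of the quotient of the algebra of
Dirichlet series by the congruence `i ~ j ⇔ ⌊n/i⌋ = ⌊n/j⌋`, the symmetrising `(0,1)`-matrix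
`T = ([x y ≤ n])_{x,y ∈ 𝒮ₙ}` ("ones on and above the antidiagonal"), and the two symmetric integer
matrices `𝒰ₙ = T ρₙ(u)` (`u = ζ` as a Dirichlet series) and `ℳₙ = T ρₙ(μ)`.  His structural results
(§2 of the paper; Lagarias–Montague 2015 §§2–4 is an exposition) are, for every `n`:

* `ρₙ` is an algebra homomorphism (`ρₙ(a ⋆ b) = ρₙ(a) ρₙ(b)`), so `ρₙ(u) ρₙ(μ) = 1`;
* `T ρₙ(a)` is symmetric for every `a`, with entries `(T ρₙ(a))_{x,y} = ∑_{k ≤ n/(xy)} a(k)`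
  (Lemma 8 / Prop. 9), in particular `𝒰ₙ = (⌊n/(xy)⌋)` and `ℳₙ = (M(⌊n/(xy)⌋))` with `M` the Mertens
  function (Prop. 11 = LM Lemma 3.4 / Thm 4.3);
* `ℳₙ = T 𝒰ₙ⁻¹ T` (Prop. 10 = LM Definition 4.1), `det T, det 𝒰ₙ, det ℳₙ ∈ {±1}`;
* `M(n)` is the `(1,1)` entry of `ℳₙ` (proof of Thm 12).

Theorem 12 of the paper (`‖ℳₙ‖₂ = O(n^{1/2+ε}) ⇒ RH`, via `|M(n)| ≤ ‖ℳₙ‖` and Littlewood) and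
LM Thm 4.4 (RH `⇔ ‖ℳₙ‖_F = O(n^{1/2+ε})`) are statements about GROWTH in `n`; they are not
formalised here and nothing in this file refers to RH.  What IS proved here in addition, because the
construction census (t9, negative-control family) pre-registers it cell by cell, is the finite-level
sign structure: for every `n ≥ 2` the three symmetric forms `T`, `𝒰ₙ`, `ℳₙ` are INDEFINITE (each has
the principal `2 × 2` block `[[*, 1], [1, 0]]` on the indices `x = 1`, `y = n`).

## Main definitions and statements (all proved; no named facts)

* `Cardinal2010.approxDiv n : Finset ℕ` — `𝒮ₙ`; `mem_approxDiv_iff` (`x ∈ 𝒮ₙ ↔ 1 ≤ x ≤ n ∧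
  ⌊n/⌊n/x⌋⌋ = x`), `div_div_div_self` (`⌊n/⌊n/⌊n/k⌋⌋⌋ = ⌊n/k⌋`), `bar` / `bar_bar` / `bar_lt_bar`
  (the order-reversing involution, Prop. 1 / LM Lemma 2.2).
* `Cardinal2010.T R n`, `Cardinal2010.rho n f` (for `f : ArithmeticFunction R`), `rho_mul`
  (homomorphism, Props. 5–6 + §2.4 / LM Thm 2.7), `rho_one`, `T_mul_rho_apply` (Lemma 8),
  `isSymm_T_mul_rho` (Prop. 9), `rho_zeta_mul_rho_moebius` (`ρ(u)ρ(μ) = 1`).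
* `Cardinal2010.U n = T ℤ n * rho n ζ`, `Cardinal2010.M n = T ℤ n * rho n μ`; `U_apply`
  (`= ⌊n/(xy)⌋`), `M_apply` / `M_apply_eq_mertensFunction` (`= M(⌊n/(xy)⌋)`) (Prop. 11),
  `M_eq_T_mul_inv_mul_T` (Prop. 10), `T_mul_T` (`T² = Eᵀ E` with `E` unitriangular) and
  `det_T_sq` / `det_T`, `det_U`, `det_M` (`= ±1`), `M_one_one` (`ℳₙ(1,1) = M(n)`, Thm 12 proof).
* `T_indefinite`, `U_indefinite`, `M_indefinite`, `not_posSemidef_T/U/M`, `not_posSemidef_neg_T/U/M`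
  (`n ≥ 2`; via a private folklore `2 × 2` witness lemma `indefinite_of_isSymm`).

* v2 (appended): the antidiagonal `y = x̄` (`U_apply_bar`, `M_apply_bar` (`= 1`),
  `U_apply_of_bar_lt`, `M_apply_of_bar_lt`, `T_apply_of_bar_lt` (`= 0` below), `U_apply_pos_of_le_bar`);
  the generators `Cardinal2010.rhoGen R n k = ρₙ(k)` (`rho_eq_sum_smul_rhoGen`, `rhoGen_mul`
  (`ρₙ(k)ρₙ(l) = ρₙ(kl)`), `rhoGen_comm`, `rhoGen_pow`, `rhoGen_pow_self_eq_zero` / `isNilpotent_rhoGen`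
  (`k ≥ 2`), `rhoGen_apply_eq_zero_of_lt` / `rhoGen_blockTriangular` (lower triangular),
  `trace_rhoGen_eq_zero`, `T_mul_rhoGen_apply` (Lemma 8 verbatim)) = LM Theorem 2.4; and
  `approxDiv_eq_union` (`𝒮ₙ = 𝒮ₙ⁻ ∪ 𝒮ₙ⁺`), `div_injOn_Icc_sqrt`, `inter_eq`, `card_approxDiv`
  (`#𝒮ₙ = 2⌊√n⌋` or `2⌊√n⌋ − 1`, Cardinal Prop. 1 / LM Def. 2.1).
* v3 (appended): the exact sign structure of `T` — `dotProduct_T_mulVec` (`wᵀTw = ∑_{x ≤ z} w(x)w(z̄)`),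
  `two_mul_form_T_of_invariant` / `form_T_pos_of_invariant` (positive definite on `bar`-invariant
  `w`), `two_mul_form_T_of_antiinvariant` / `form_T_neg_of_antiinvariant` (negative definite on
  anti-invariant `w`), `card_fixed_le_one`, `two_mul_card_lt_bar_add_card_fixed`
  (`2·#{x < x̄} + #{x = x̄} = s`): the inertia of `T` is `(⌈s/2⌉, 0, ⌊s/2⌋)`.

Design: matrices are indexed by the Finset `𝒮ₙ` itself (coerced to a type, with the order of `ℕ`),
not by `Fin s`; Cardinal's "`i + j ≤ s + 1`" description of `T` becomes `x y ≤ n` through the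
involution (Lemma 8: `(Tρ(k))_{ij} = 1 ⇔ i j ≤ ⌊n/k⌋ ⇔ k ≤ ⌊n/ij⌋`).  `ρₙ` is defined directly on
arithmetic functions `f` (Cardinal's `ρ ∘ π̄`): `ρₙ(f)_{x,y} = ∑_{k ≤ n, ⌊n/(yk)⌋ = ⌊n/x⌋} f(k)`, i.e.
column `y` of `ρₙ(e_k)` has its `1` in the row of the class of `y k`.

## References

* [Cardinal2010] J.-P. Cardinal, *Symmetric matrices related to the Mertens function*, Linear
  Algebra Appl. 432 (2010) 161–172 = arXiv:0811.3701: §2.1 Def. 1, Prop. 1, Lemma 2, Prop. 3;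
  §2.4 Def. 3 (T), Lemma 8, Props. 9, 10; §2.5 Prop. 11, Thm 12 (read at page, arXiv v2).
* [LagariasMontague2015] J. C. Lagarias, D. Montague, *Notes on Cardinal's matrices*,
  arXiv:1511.08154: Def. 2.1, Lemma 2.2, Thm 2.4, Thm 2.7, §2.4, Thm 3.1, Lemma 3.4, Def. 4.1,
  Thm 4.3, Thm 4.4 (read at page).

## Mathlib / tree search

No approximate divisors / Cardinal matrices in Mathlib or the tree (`lean search` 2026-08-20:
`approxDiv`, `Cardinal`, "floor quotient set" — no hits).  Used: `ArithmeticFunction` (`mul_apply`,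
`one_apply`, `coe_zeta_mul_moebius`, `Nat.mem_divisorsAntidiagonal`), `Matrix.det_of_lowerTriangular`,
`Matrix.mul_inv_rev`, `Matrix.inv_eq_right_inv`, `Matrix.nonsing_inv_mul`,
`Matrix.posSemidef_iff_dotProduct_mulVec`; tree: `LFunctions.mertensFunction` (`RHWave0.lean`),
cf. `Redheffer.det_redheffer` and `Mikolas1949.sum_mertens_div_eq_one` in this directory.
-/

open Finset Matrix
open scoped ArithmeticFunction.Moebius ArithmeticFunction.zeta

namespace Literature.NumberTheory.Multiplicative

namespace Cardinal2010

/-! ## Approximate divisors `𝒮ₙ` and the involution `k ↦ ⌊n/k⌋` -/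

/-- The set `𝒮ₙ = {⌊n/k⌋ : 1 ≤ k ≤ n}` of **approximate divisors** of `n` (Cardinal's set `𝒮` of
largest representatives of the bounded classes of `i ~ j ⇔ ⌊n/i⌋ = ⌊n/j⌋`).
[cite: Cardinal2010, §2.1 Definition 1 and Proposition 1; LagariasMontague2015, Definition 2.1] -/
def approxDiv (n : ℕ) : Finset ℕ := (Icc 1 n).image fun k => n / k

/-- `⌊n/⌊n/⌊n/k⌋⌋⌋ = ⌊n/k⌋` for all naturals (with `n / 0 = 0`): the largest element of the class
of `⌊n/k⌋` is `⌊n/k⌋` itself. [cite: Cardinal2010, Proposition 1 (proof)] -/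
theorem div_div_div_self (n k : ℕ) : n / (n / (n / k)) = n / k := by
  rcases Nat.eq_zero_or_pos (n / k) with hq | hq
  · rw [hq, Nat.div_zero, Nat.div_zero]
  have hk : 0 < k := Nat.pos_of_ne_zero (by rintro rfl; simp at hq)
  have hr : 0 < n / (n / k) := Nat.div_pos (Nat.div_le_self n k) hq
  apply le_antisymm
  · exact Nat.div_le_div_left ((Nat.le_div_iff_mul_le hq).2 (Nat.mul_div_le n k)) hk
  · exact (Nat.le_div_iff_mul_le hr).2 (Nat.mul_div_le n (n / k))

/-- Membership in `𝒮ₙ`, unfolded. [cite: Cardinal2010, Definition 1] -/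
theorem mem_approxDiv {n x : ℕ} : x ∈ approxDiv n ↔ ∃ k, (1 ≤ k ∧ k ≤ n) ∧ n / k = x := by
  simp [approxDiv, Finset.mem_image, Finset.mem_Icc]

/-- `⌊n/k⌋ ∈ 𝒮ₙ` for `1 ≤ k ≤ n`. [cite: Cardinal2010, Definition 1] -/
theorem div_mem_approxDiv {n k : ℕ} (hk : 1 ≤ k) (hkn : k ≤ n) : n / k ∈ approxDiv n :=
  mem_approxDiv.2 ⟨k, ⟨hk, hkn⟩, rfl⟩

/-- Elements of `𝒮ₙ` are `≥ 1`. [cite: Cardinal2010, Proposition 1] -/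
theorem one_le_of_mem {n x : ℕ} (hx : x ∈ approxDiv n) : 1 ≤ x := by
  obtain ⟨k, ⟨hk, hkn⟩, rfl⟩ := mem_approxDiv.1 hx
  exact Nat.div_pos hkn hk

/-- Elements of `𝒮ₙ` are `≤ n`. [cite: Cardinal2010, Proposition 1] -/
theorem le_of_mem {n x : ℕ} (hx : x ∈ approxDiv n) : x ≤ n := by
  obtain ⟨k, -, rfl⟩ := mem_approxDiv.1 hx
  exact Nat.div_le_self n k

/-- For `x ∈ 𝒮ₙ`, `⌊n/⌊n/x⌋⌋ = x` (`x` is the largest element of its class).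
[cite: Cardinal2010, Proposition 1 (`k̄̄ = k`)] -/
theorem div_div_of_mem {n x : ℕ} (hx : x ∈ approxDiv n) : n / (n / x) = x := by
  obtain ⟨k, -, rfl⟩ := mem_approxDiv.1 hx
  exact div_div_div_self n k

/-- Characterisation: `x ∈ 𝒮ₙ ↔ 1 ≤ x ≤ n ∧ ⌊n/⌊n/x⌋⌋ = x`.
[cite: Cardinal2010, Proposition 1; LagariasMontague2015, Definition 2.1] -/
theorem mem_approxDiv_iff {n x : ℕ} : x ∈ approxDiv n ↔ 1 ≤ x ∧ x ≤ n ∧ n / (n / x) = x := by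
  constructor
  · exact fun hx => ⟨one_le_of_mem hx, le_of_mem hx, div_div_of_mem hx⟩
  · rintro ⟨h1, h2, h3⟩
    rw [← h3]
    exact div_mem_approxDiv (Nat.div_pos h2 h1) (Nat.div_le_self n x)

/-- `𝒮ₙ` is stable under `x ↦ ⌊n/x⌋`. [cite: Cardinal2010, Proposition 1 (`k̄ ∈ 𝒮`)] -/
theorem div_mem_of_mem {n x : ℕ} (hx : x ∈ approxDiv n) : n / x ∈ approxDiv n :=
  div_mem_approxDiv (one_le_of_mem hx) (le_of_mem hx)

/-- Two approximate divisors with the same quotient `⌊n/·⌋` are equal (each class has exactly one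
representative in `𝒮ₙ`). [cite: Cardinal2010, Definition 1 and Proposition 1] -/
theorem eq_of_div_eq_div {n x y : ℕ} (hx : x ∈ approxDiv n) (hy : y ∈ approxDiv n)
    (h : n / x = n / y) : x = y := by
  rw [← div_div_of_mem hx, ← div_div_of_mem hy, h]

/-- `1 ∈ 𝒮ₙ` for `n ≥ 1` (`1 = ⌊n/n⌋`). [cite: LagariasMontague2015, Lemma 2.2 (`k₁ = 1`)] -/
theorem one_mem {n : ℕ} (hn : 1 ≤ n) : 1 ∈ approxDiv n := by
  have h := div_mem_approxDiv hn le_rfl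
  rwa [Nat.div_self hn] at h

/-- `n ∈ 𝒮ₙ` for `n ≥ 1` (`n = ⌊n/1⌋`). [cite: LagariasMontague2015, Lemma 2.2 (`k_s = n`)] -/
theorem self_mem {n : ℕ} (hn : 1 ≤ n) : n ∈ approxDiv n := by
  have h := div_mem_approxDiv le_rfl hn
  rwa [Nat.div_one] at h

/-- `𝒮ₙ` is nonempty only for `n ≥ 1` (used to discharge `n ≥ 1` from an index `x : 𝒮ₙ`).
[folklore] -/
private theorem one_le_of_mem' {n x : ℕ} (hx : x ∈ approxDiv n) : 1 ≤ n :=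
  (one_le_of_mem hx).trans (le_of_mem hx)

/-- For `1 ≤ m ≤ n`, the representative `⌊n/⌊n/m⌋⌋` of the class of `m` lies in `𝒮ₙ`.
[cite: Cardinal2010, Definition 1 (largest representative)] -/
theorem rep_mem {n m : ℕ} (h1 : 1 ≤ m) (h2 : m ≤ n) : n / (n / m) ∈ approxDiv n :=
  div_mem_approxDiv (Nat.div_pos h2 h1) (Nat.div_le_self n m)

/-- **Cardinal's involution** `x ↦ x̄ = ⌊n/x⌋` of `𝒮ₙ`.
[cite: Cardinal2010, Proposition 1; LagariasMontague2015, Lemma 2.2] -/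
def bar {n : ℕ} (x : approxDiv n) : approxDiv n := ⟨n / (x : ℕ), div_mem_of_mem x.2⟩

/-- `x̄ = ⌊n/x⌋` as a natural number. [cite: Cardinal2010, Proposition 1] -/
@[simp] theorem coe_bar {n : ℕ} (x : approxDiv n) : ((bar x : approxDiv n) : ℕ) = n / (x : ℕ) := rfl

/-- `x̄̄ = x`. [cite: Cardinal2010, Proposition 1; LagariasMontague2015, Lemma 2.2] -/
@[simp] theorem bar_bar {n : ℕ} (x : approxDiv n) : bar (bar x) = x :=
  Subtype.ext (div_div_of_mem x.2)

/-- `bar` is an involution. [cite: Cardinal2010, Proposition 1] -/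
theorem bar_involutive (n : ℕ) : Function.Involutive (bar (n := n)) := bar_bar

/-- The involution as a permutation of `𝒮ₙ`. [cite: Cardinal2010, Proposition 1] -/
def barEquiv (n : ℕ) : Equiv.Perm (approxDiv n) := (bar_involutive n).toPerm _

/-- `barEquiv` is `bar`. [cite: Cardinal2010, Proposition 1] -/
@[simp] theorem barEquiv_apply {n : ℕ} (x : approxDiv n) : barEquiv n x = bar x := rfl

/-- `m·x ≤ n ↔ m ≤ x̄` — the translation between Cardinal's "`i + j ≤ s + 1`" and `x y ≤ n`.
[cite: Cardinal2010, Lemma 8 (proof)] -/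
theorem mul_le_iff_le_bar {n : ℕ} (x : approxDiv n) (m : ℕ) :
    m * (x : ℕ) ≤ n ↔ m ≤ ((bar x : approxDiv n) : ℕ) :=
  (Nat.le_div_iff_mul_le (one_le_of_mem x.2)).symm

/-- `bar` is strictly order-reversing ("`k ↦ k̄` is just the order reversing map on `𝒮`";
`k̂ᵢ = k_{s+1-i}`). [cite: Cardinal2010, Proposition 1; LagariasMontague2015, Lemma 2.2] -/
theorem bar_lt_bar {n : ℕ} {x y : approxDiv n} (h : x < y) : bar y < bar x := by
  have hle : ((bar y : approxDiv n) : ℕ) ≤ ((bar x : approxDiv n) : ℕ) :=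
    Nat.div_le_div_left (le_of_lt (show (x : ℕ) < y from h)) (one_le_of_mem x.2)
  refine lt_of_le_of_ne hle fun heq => ?_
  have hxy : y = x := by rw [← bar_bar y, ← bar_bar x, heq]
  exact absurd h (by rw [hxy]; exact lt_irrefl _)

/-! ## The symmetrising matrix `T` and the regular representation `ρₙ` -/

section Ring

variable (R : Type*) [CommRing R]

/-- **Cardinal's matrix `T`**: `T_{x,y} = 1` if `x y ≤ n` and `0` otherwise (`x, y ∈ 𝒮ₙ`); in the
increasing enumeration `k₁ < ⋯ < k_s` of `𝒮ₙ` this is "`1` on and above the antidiagonal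
`i + j = s + 1`, `0` strictly below" since `kᵢ kⱼ ≤ n ⇔ kⱼ ≤ k̄ᵢ = k_{s+1-i}`.
[cite: Cardinal2010, Definition 3 and Lemma 8; LagariasMontague2015, Definition 4.1] -/
def T (n : ℕ) : Matrix (approxDiv n) (approxDiv n) R :=
  Matrix.of fun x y => if (x : ℕ) * y ≤ n then (1 : R) else 0

variable {R}

/-- Entry formula for `T`. [cite: Cardinal2010, Definition 3] -/
theorem T_apply {n : ℕ} (x y : approxDiv n) :
    T R n x y = if (x : ℕ) * y ≤ n then (1 : R) else 0 := rfl

/-- `T` is symmetric. [cite: Cardinal2010, Definition 3] -/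
theorem isSymm_T (n : ℕ) : (T R n).IsSymm :=
  Matrix.IsSymm.ext fun x y => by rw [T_apply, T_apply, mul_comm]

/-- **Cardinal's regular representation**, composed with the projection from arithmetic functions
(`ρ ∘ π̄` of the paper; `ρ̃ₙ` of Lagarias–Montague): for `f : ℕ → R` (only the values `f 1, …, f n`
matter), `ρₙ(f)_{x,y} = ∑_{1 ≤ k ≤ n, ⌊n/(yk)⌋ = ⌊n/x⌋} f(k)` — column `y` of `ρₙ(e_k)` has a single
`1`, in the row of the representative of the class of `y·k` (zero column if `y k > n`).
[cite: Cardinal2010, §2.4 and Lemma 8 (proof); LagariasMontague2015, Theorems 2.4 and 2.7] -/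
def rho (n : ℕ) (f : ArithmeticFunction R) : Matrix (approxDiv n) (approxDiv n) R :=
  Matrix.of fun x y => ∑ k ∈ Icc 1 n, if n / ((y : ℕ) * k) = n / (x : ℕ) then f k else 0

/-- Entry formula for `rho`. [cite: Cardinal2010, §2.4] -/
theorem rho_apply {n : ℕ} (f : ArithmeticFunction R) (x y : approxDiv n) :
    rho n f x y = ∑ k ∈ Icc 1 n, if n / ((y : ℕ) * k) = n / (x : ℕ) then f k else 0 := rfl

/-- The class of `m` meets `𝒮ₙ` in exactly one point when `1 ≤ m ≤ n` (namely `⌊n/⌊n/m⌋⌋`) and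
not at all otherwise: a sum over `z ∈ 𝒮ₙ` restricted to `⌊n/m⌋ = ⌊n/z⌋` collapses accordingly.
[cite: Cardinal2010, Definition 1 and Proposition 1] -/
theorem sum_ite_div_eq {n : ℕ} {A : Type*} [AddCommMonoid A] (m : ℕ) (F : approxDiv n → A) :
    (∑ z : approxDiv n, if n / m = n / (z : ℕ) then F z else 0) =
      if h : 1 ≤ m ∧ m ≤ n then F ⟨n / (n / m), rep_mem h.1 h.2⟩ else 0 := by
  by_cases h : 1 ≤ m ∧ m ≤ n
  · rw [dif_pos h]
    rw [Fintype.sum_eq_single (⟨n / (n / m), rep_mem h.1 h.2⟩ : approxDiv n)]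
    · rw [if_pos]
      exact (div_div_div_self n m).symm
    · intro z hz
      rw [if_neg]
      intro hmz
      apply hz
      apply Subtype.ext
      show (z : ℕ) = n / (n / m)
      rw [hmz, div_div_of_mem z.2]
  · rw [dif_neg h]
    refine Fintype.sum_eq_zero _ fun z => if_neg fun hmz => h ?_
    have hz1 : 1 ≤ n / (z : ℕ) := Nat.div_pos (le_of_mem z.2) (one_le_of_mem z.2)
    rw [← hmz] at hz1
    refine ⟨Nat.pos_of_ne_zero ?_, ?_⟩
    · rintro rfl
      simp at hz1
    · by_contra hmn
      rw [Nat.div_eq_of_lt (lt_of_not_ge hmn)] at hz1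
      exact absurd hz1 (by decide)

/-- **Lemma 8 (generalised to arithmetic functions)**: `(T ρₙ(f))_{x,y} = ∑_{k ≤ ⌊n/(xy)⌋} f(k)`;
for `f = e_k` this is Cardinal's `(Tρ(k))_{i,j} = 1 ⇔ i j ≤ ⌊n/k⌋ ⇔ k ≤ ⌊n/ij⌋`.
[cite: Cardinal2010, Lemma 8 and Proposition 11 (proof); LagariasMontague2015, Lemma 3.4] -/
theorem T_mul_rho_apply {n : ℕ} (f : ArithmeticFunction R) (x y : approxDiv n) :
    (T R n * rho n f) x y = ∑ k ∈ Icc 1 (n / ((x : ℕ) * y)), f k := by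
  have hx := one_le_of_mem x.2
  have hy := one_le_of_mem y.2
  rw [Matrix.mul_apply]
  simp_rw [T_apply, rho_apply, Finset.mul_sum]
  rw [Finset.sum_comm]
  -- inner sum over `z` for fixed `k`
  have inner : ∀ k ∈ Icc 1 n,
      (∑ z : approxDiv n, (if (x : ℕ) * z ≤ n then (1 : R) else 0) *
          (if n / ((y : ℕ) * k) = n / (z : ℕ) then f k else 0)) =
        if (x : ℕ) * y * k ≤ n then f k else 0 := by
    intro k hk
    have hk1 : 1 ≤ k := (Finset.mem_Icc.1 hk).1
    have step : ∀ z : approxDiv n, (if (x : ℕ) * z ≤ n then (1 : R) else 0) *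
        (if n / ((y : ℕ) * k) = n / (z : ℕ) then f k else 0) =
        if n / ((y : ℕ) * k) = n / (z : ℕ) then (if (x : ℕ) * z ≤ n then f k else 0) else 0 := by
      intro z
      split_ifs <;> simp
    simp_rw [step]
    rw [sum_ite_div_eq]
    by_cases hyk : (y : ℕ) * k ≤ n
    · have h1 : 1 ≤ (y : ℕ) * k := Nat.mul_pos hy hk1
      rw [dif_pos ⟨h1, hyk⟩]
      have key : (x : ℕ) * (n / (n / ((y : ℕ) * k))) ≤ n ↔ (x : ℕ) * y * k ≤ n := by
        rw [← Nat.le_div_iff_mul_le (Nat.div_pos (Nat.div_le_self _ _)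
          (Nat.div_pos hyk h1)), div_div_div_self, Nat.le_div_iff_mul_le h1, mul_assoc]
      simp only [key]
    · rw [dif_neg (fun h => hyk h.2), if_neg]
      intro h
      exact hyk (le_trans (Nat.le_mul_of_pos_left _ (by positivity) |>.trans_eq
        (by ring)) h)
  rw [Finset.sum_congr rfl inner, ← Finset.sum_filter]
  apply Finset.sum_congr _ fun _ _ => rfl
  ext k
  simp only [Finset.mem_filter, Finset.mem_Icc]
  have hxy : 0 < (x : ℕ) * y := Nat.mul_pos hx hy
  constructor
  · rintro ⟨⟨h1, -⟩, h3⟩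
    exact ⟨h1, (Nat.le_div_iff_mul_le hxy).2 (by rw [mul_comm]; exact h3)⟩
  · rintro ⟨h1, h2⟩
    have h3 : (x : ℕ) * y * k ≤ n := by rw [mul_comm]; exact (Nat.le_div_iff_mul_le hxy).1 h2
    exact ⟨⟨h1, le_trans (Nat.le_mul_of_pos_left k hxy) h3⟩, h3⟩


/-- `T ρₙ(f)` is symmetric for every `f` ("Proposition 9: for all `a ∈ 𝒜̄`, `Tρ(a)` is symmetric";
Lagarias–Montague Thm 3.1). [cite: Cardinal2010, Proposition 9; LagariasMontague2015, Theorem 3.1] -/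
theorem isSymm_T_mul_rho {n : ℕ} (f : ArithmeticFunction R) : (T R n * rho n f).IsSymm :=
  Matrix.IsSymm.ext fun x y => by rw [T_mul_rho_apply, T_mul_rho_apply, mul_comm]

/-- `ρₙ(δ) = 1` (`δ = e₁`, the unit of the Dirichlet algebra; `ρ(𝟏)` is the identity matrix).
[cite: Cardinal2010, §2.4; LagariasMontague2015, Theorem 2.4] -/
theorem rho_one (n : ℕ) : rho n (1 : ArithmeticFunction R) = 1 := by
  ext x y
  rw [rho_apply, Matrix.one_apply]
  have hn : 1 ≤ n := one_le_of_mem' x.2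
  rw [Finset.sum_eq_single_of_mem 1 (Finset.mem_Icc.2 ⟨le_rfl, hn⟩)]
  · rw [ArithmeticFunction.one_one, mul_one]
    by_cases hxy : x = y
    · subst hxy
      simp
    · rw [if_neg hxy, if_neg]
      intro h
      exact hxy (Subtype.ext (eq_of_div_eq_div x.2 y.2 h.symm))
  · intro k _ hk1
    rw [ArithmeticFunction.one_apply_ne hk1]
    simp

/-- The `z`-sum behind the homomorphism property: composing "class of `z k` is `x`" with
"class of `y l` is `z`" gives "class of `y k l` is `x`" (compatibility of the congruence with
multiplication, Prop. 3, and `⌊⌊n/i⌋/j⌋ = ⌊n/ij⌋`, Lemma 2).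
[cite: Cardinal2010, Lemma 2 and Proposition 3] -/
theorem sum_rho_mul_rho_aux {n : ℕ} (x y : approxDiv n) {k l : ℕ} (hk : 1 ≤ k) (hl : 1 ≤ l)
    (a b : R) :
    (∑ z : approxDiv n, (if n / ((z : ℕ) * k) = n / (x : ℕ) then a else 0) *
        (if n / ((y : ℕ) * l) = n / (z : ℕ) then b else 0)) =
      if n / ((y : ℕ) * (k * l)) = n / (x : ℕ) then a * b else 0 := by
  have step : ∀ z : approxDiv n, (if n / ((z : ℕ) * k) = n / (x : ℕ) then a else 0) *
      (if n / ((y : ℕ) * l) = n / (z : ℕ) then b else 0) =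
      if n / ((y : ℕ) * l) = n / (z : ℕ) then
        (if n / ((z : ℕ) * k) = n / (x : ℕ) then a * b else 0) else 0 := by
    intro z
    split_ifs <;> simp
  simp_rw [step]
  rw [sum_ite_div_eq]
  by_cases hyl : (y : ℕ) * l ≤ n
  · have h1 : 1 ≤ (y : ℕ) * l := Nat.mul_pos (one_le_of_mem y.2) hl
    rw [dif_pos ⟨h1, hyl⟩]
    have key : n / (n / (n / ((y : ℕ) * l)) * k) = n / ((y : ℕ) * (k * l)) := by
      rw [← Nat.div_div_eq_div_mul, div_div_div_self, Nat.div_div_eq_div_mul, mul_comm k l,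
        mul_assoc]
    simp only [key]
  · rw [dif_neg (fun h => hyl h.2), if_neg]
    intro h
    have hlt : n < (y : ℕ) * (k * l) :=
      lt_of_lt_of_le (lt_of_not_ge hyl) (Nat.mul_le_mul_left _ (Nat.le_mul_of_pos_left l hk))
    rw [Nat.div_eq_of_lt hlt] at h
    exact absurd h.symm (Nat.ne_of_gt (Nat.div_pos (le_of_mem x.2) (one_le_of_mem x.2)))

/-- **`ρₙ` is an algebra homomorphism**: `ρₙ(f ⋆ g) = ρₙ(f) ρₙ(g)` for the Dirichlet convolution
`⋆` (Cardinal: `ϑ`, `π̄ = ϖ ∘ ϑ` are algebra morphisms and `ρ` is the regular representation;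
Lagarias–Montague Thm 2.7). [cite: Cardinal2010, Propositions 5, 6 and §2.4;
LagariasMontague2015, Theorem 2.7] -/
theorem rho_mul {n : ℕ} (f g : ArithmeticFunction R) : rho n (f * g) = rho n f * rho n g := by
  ext x y
  have hx1 : 1 ≤ n / (x : ℕ) := Nat.div_pos (le_of_mem x.2) (one_le_of_mem x.2)
  -- the common value: a sum over pairs `(k, l)` with `k l ≤ n`
  set P : Finset (ℕ × ℕ) := (Icc 1 n ×ˢ Icc 1 n).filter fun p => p.1 * p.2 ≤ n with hP
  set F : ℕ × ℕ → R := fun p => if n / ((y : ℕ) * (p.1 * p.2)) = n / (x : ℕ) then f p.1 * g p.2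
    else 0 with hF
  have hFzero : ∀ p ∈ Icc 1 n ×ˢ Icc 1 n, F p ≠ 0 → p.1 * p.2 ≤ n := by
    intro p _ hp
    by_contra hgt
    apply hp
    simp only [hF]
    rw [if_neg]
    rw [Nat.div_eq_of_lt (lt_of_lt_of_le (lt_of_not_ge hgt)
      (Nat.le_mul_of_pos_left _ (one_le_of_mem y.2)))]
    exact (Nat.ne_of_gt hx1).symm
  -- right-hand side
  have hR : (rho n f * rho n g) x y = ∑ p ∈ P, F p := by
    rw [Matrix.mul_apply]
    simp_rw [rho_apply, Finset.sum_mul_sum]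
    rw [Finset.sum_comm]
    have hzl : ∀ k ∈ Icc 1 n, (∑ z : approxDiv n, ∑ l ∈ Icc 1 n,
        (if n / ((z : ℕ) * k) = n / (x : ℕ) then f k else 0) *
          (if n / ((y : ℕ) * l) = n / (z : ℕ) then g l else 0)) =
        ∑ l ∈ Icc 1 n, F (k, l) := by
      intro k hk
      rw [Finset.sum_comm]
      refine Finset.sum_congr rfl fun l hl => ?_
      exact sum_rho_mul_rho_aux x y (Finset.mem_Icc.1 hk).1 (Finset.mem_Icc.1 hl).1 (f k) (g l)
    rw [Finset.sum_congr rfl hzl, ← Finset.sum_product (s := Icc 1 n) (t := Icc 1 n) (f := F), hP,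
      Finset.sum_filter_of_ne hFzero]
  -- left-hand side
  have hL : rho n (f * g) x y = ∑ p ∈ P, F p := by
    rw [rho_apply]
    have hmaps : ∀ p ∈ P, p.1 * p.2 ∈ Icc 1 n := by
      intro p hp
      simp only [hP, Finset.mem_filter, Finset.mem_product, Finset.mem_Icc] at hp
      exact Finset.mem_Icc.2 ⟨Nat.mul_pos hp.1.1.1 hp.1.2.1, hp.2⟩
    rw [← Finset.sum_fiberwise_of_maps_to hmaps]
    refine Finset.sum_congr rfl fun m hm => ?_
    have hm1 : 1 ≤ m := (Finset.mem_Icc.1 hm).1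
    have hmn : m ≤ n := (Finset.mem_Icc.1 hm).2
    have hfib : P.filter (fun p => p.1 * p.2 = m) = Nat.divisorsAntidiagonal m := by
      ext p
      simp only [hP, Finset.mem_filter, Finset.mem_product, Finset.mem_Icc,
        Nat.mem_divisorsAntidiagonal]
      constructor
      · rintro ⟨-, h2⟩
        exact ⟨h2, by omega⟩
      · rintro ⟨h1, -⟩
        have hp1 : 1 ≤ p.1 := Nat.pos_of_ne_zero fun h0 => by
          rw [h0, zero_mul] at h1; omega
        have hp2 : 1 ≤ p.2 := Nat.pos_of_ne_zero fun h0 => by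
          rw [h0, mul_zero] at h1; omega
        refine ⟨⟨⟨⟨hp1, ?_⟩, ⟨hp2, ?_⟩⟩, ?_⟩, h1⟩
        · calc p.1 ≤ p.1 * p.2 := Nat.le_mul_of_pos_right _ hp2
            _ ≤ n := h1 ▸ hmn
        · calc p.2 ≤ p.1 * p.2 := Nat.le_mul_of_pos_left _ hp1
            _ ≤ n := h1 ▸ hmn
        · exact h1 ▸ hmn
    rw [hfib, ArithmeticFunction.mul_apply]
    by_cases hc : n / ((y : ℕ) * m) = n / (x : ℕ)
    · rw [if_pos hc]
      refine Finset.sum_congr rfl fun p hp => ?_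
      have hpm : p.1 * p.2 = m := (Nat.mem_divisorsAntidiagonal.1 hp).1
      simp only [hF, hpm, hc, if_true]
    · rw [if_neg hc]
      symm
      refine Finset.sum_eq_zero fun p hp => ?_
      have hpm : p.1 * p.2 = m := (Nat.mem_divisorsAntidiagonal.1 hp).1
      simp only [hF, hpm, hc, if_false]
  rw [hL, hR]

/-- `ρₙ` is commutative: `ρₙ(f) ρₙ(g) = ρₙ(g) ρₙ(f)` ("this algebra is commutative").
[cite: Cardinal2010, §2.4; LagariasMontague2015, Theorem 2.4] -/
theorem rho_comm {n : ℕ} (f g : ArithmeticFunction R) : rho n f * rho n g = rho n g * rho n f := by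
  rw [← rho_mul, ← rho_mul, mul_comm]

/-! ## `det T = ±1`: `T² = Eᵀ E` with `E` unitriangular -/

variable (R) in
/-- The unitriangular matrix `E_{w,x} = [x ≤ w]` on `𝒮ₙ`. [folklore] -/
def upper (n : ℕ) : Matrix (approxDiv n) (approxDiv n) R :=
  Matrix.of fun w x => if (x : ℕ) ≤ w then (1 : R) else 0

/-- Entry formula for `upper`. [folklore] -/
private theorem upper_apply {n : ℕ} (w x : approxDiv n) :
    upper R n w x = if (x : ℕ) ≤ w then (1 : R) else 0 := rfl

/-- `T² = Eᵀ E`: `(T²)_{x,y} = #{z ∈ 𝒮ₙ : xz ≤ n, zy ≤ n} = #{w ∈ 𝒮ₙ : x ≤ w, y ≤ w}` via the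
involution `z = w̄`. [cite: Cardinal2010, Proposition 1 and Definition 3] -/
theorem T_mul_T (n : ℕ) : T R n * T R n = (upper R n)ᵀ * upper R n := by
  ext x y
  rw [Matrix.mul_apply, Matrix.mul_apply,
    ← Equiv.sum_comp (barEquiv n) (fun z => T R n x z * T R n z y)]
  refine Finset.sum_congr rfl fun w _ => ?_
  have h1 := mul_le_iff_le_bar (bar w) (x : ℕ)
  have h2 := mul_le_iff_le_bar (bar w) (y : ℕ)
  rw [bar_bar] at h1 h2
  rw [coe_bar] at h1 h2
  rw [barEquiv_apply, Matrix.transpose_apply, T_apply, T_apply, upper_apply, upper_apply, coe_bar,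
    mul_comm (n / (w : ℕ)) (y : ℕ)]
  simp only [h1, h2]

/-- `det E = 1` (`E` is lower triangular with unit diagonal for the order of `ℕ`). [folklore] -/
private theorem det_upper (n : ℕ) : (upper R n).det = 1 := by
  have hT : (upper R n).BlockTriangular OrderDual.toDual := by
    intro i j hij
    have h1 : i < j := OrderDual.toDual_lt_toDual.1 hij
    have h2 : ¬ ((j : ℕ) ≤ (i : ℕ)) := not_le.2 h1
    rw [upper_apply, if_neg h2]
  rw [Matrix.det_of_lowerTriangular _ hT]
  exact Finset.prod_eq_one fun i _ => by rw [upper_apply, if_pos le_rfl]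

/-- `(det T)² = 1`. [cite: Cardinal2010, Definition 3; LagariasMontague2015, §1 (`det = ±1`)] -/
theorem det_T_mul_det_T (n : ℕ) : (T R n).det * (T R n).det = 1 := by
  rw [← Matrix.det_mul, T_mul_T, Matrix.det_mul, Matrix.det_transpose, det_upper, mul_one]

/-- `det T` is a unit. [cite: LagariasMontague2015, §1] -/
theorem isUnit_det_T (n : ℕ) : IsUnit (T R n).det := IsUnit.of_mul_eq_one _ (det_T_mul_det_T n)

end Ring

/-! ## Cardinal's `𝒰ₙ` and `ℳₙ` over `ℤ` -/

/-- `ρₙ(u) ρₙ(μ) = 1` (`μ = u⁻¹` in the Dirichlet algebra, hence `Zₙ⁻¹ = ρₙ(μ)`: "a finite analogue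
of the inverse of the Riemann zeta function").
[cite: Cardinal2010, Properties 4 and Proposition 10 (proof); LagariasMontague2015, §2.4] -/
theorem rho_zeta_mul_rho_moebius (n : ℕ) :
    rho n (ζ : ArithmeticFunction ℤ) * rho n (μ : ArithmeticFunction ℤ) = 1 := by
  rw [← rho_mul, ArithmeticFunction.coe_zeta_mul_moebius, rho_one]

/-- `ρₙ(μ) ρₙ(u) = 1`. [cite: Cardinal2010, Properties 4; LagariasMontague2015, §2.4] -/
theorem rho_moebius_mul_rho_zeta (n : ℕ) :
    rho n (μ : ArithmeticFunction ℤ) * rho n (ζ : ArithmeticFunction ℤ) = 1 := by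
  rw [← rho_mul, ArithmeticFunction.moebius_mul_coe_zeta, rho_one]

/-- `ρₙ(u)⁻¹ = ρₙ(μ)` (`Zₙ⁻¹ = ρₙ(μ)`). [cite: LagariasMontague2015, §2.4] -/
theorem inv_rho_zeta (n : ℕ) :
    (rho n (ζ : ArithmeticFunction ℤ))⁻¹ = rho n (μ : ArithmeticFunction ℤ) :=
  Matrix.inv_eq_right_inv (rho_zeta_mul_rho_moebius n)

/-- **Cardinal's matrix `𝒰ₙ = T ρₙ(u)`** (`= T Zₙ`, the symmetrised finite zeta).
[cite: Cardinal2010, Proposition 10; LagariasMontague2015, §3.2] -/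
def U (n : ℕ) : Matrix (approxDiv n) (approxDiv n) ℤ := T ℤ n * rho n (ζ : ArithmeticFunction ℤ)

/-- **Cardinal's Mertens matrix `ℳₙ = T ρₙ(μ)`** (`= T Zₙ⁻¹`).
[cite: Cardinal2010, Proposition 10; LagariasMontague2015, Definition 4.1 (second display)] -/
def M (n : ℕ) : Matrix (approxDiv n) (approxDiv n) ℤ := T ℤ n * rho n (μ : ArithmeticFunction ℤ)

/-- **Proposition 11 (first half)**: `𝒰ₙ = (⌊n/(xy)⌋)_{x,y ∈ 𝒮ₙ}`.
[cite: Cardinal2010, Proposition 11; LagariasMontague2015, Lemma 3.4] -/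
theorem U_apply {n : ℕ} (x y : approxDiv n) : U n x y = ((n / ((x : ℕ) * y) : ℕ) : ℤ) := by
  rw [U, T_mul_rho_apply]
  have h : ∀ k ∈ Icc 1 (n / ((x : ℕ) * y)), ((ζ : ArithmeticFunction ℤ) k) = 1 := by
    intro k hk
    have hk0 : k ≠ 0 := by have := (Finset.mem_Icc.1 hk).1; omega
    rw [ArithmeticFunction.natCoe_apply, ArithmeticFunction.zeta_apply, if_neg hk0, Nat.cast_one]
  rw [Finset.sum_congr rfl h]
  simp

/-- **Proposition 11 (second half) = Lagarias–Montague Thm 4.3**: `ℳₙ = (M(⌊n/(xy)⌋))_{x,y ∈ 𝒮ₙ}`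
with `M(N) = ∑_{k ≤ N} μ(k)` the Mertens function.
[cite: Cardinal2010, Proposition 11; LagariasMontague2015, Theorem 4.3] -/
theorem M_apply {n : ℕ} (x y : approxDiv n) : M n x y = ∑ k ∈ Icc 1 (n / ((x : ℕ) * y)), μ k := by
  rw [M, T_mul_rho_apply]

/-- `ℳₙ(x,y) = M(⌊n/(xy)⌋)` in the tree's vocabulary `LFunctions.mertensFunction`.
[cite: Cardinal2010, Proposition 11; LagariasMontague2015, Theorem 4.3] -/
theorem M_apply_eq_mertensFunction {n : ℕ} (x y : approxDiv n) :
    M n x y = LFunctions.mertensFunction ((n / ((x : ℕ) * y) : ℕ) : ℝ) := by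
  rw [M_apply, LFunctions.mertensFunction, Nat.floor_natCast]
  have h : Finset.Icc 1 (n / ((x : ℕ) * y)) = Finset.Ioc 0 (n / ((x : ℕ) * y)) := by
    rw [← Finset.Icc_add_one_left_eq_Ioc, zero_add]
  rw [h]

/-- `𝒰ₙ` is symmetric. [cite: Cardinal2010, Proposition 10] -/
theorem isSymm_U (n : ℕ) : (U n).IsSymm := isSymm_T_mul_rho _

/-- `ℳₙ` is symmetric. [cite: Cardinal2010, Proposition 10; LagariasMontague2015, Definition 4.1] -/
theorem isSymm_M (n : ℕ) : (M n).IsSymm := isSymm_T_mul_rho _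

/-- **Proposition 10**: `ℳₙ = T 𝒰ₙ⁻¹ T` (Lagarias–Montague take this as the definition of `ℳₙ`).
[cite: Cardinal2010, Proposition 10; LagariasMontague2015, Definition 4.1] -/
theorem M_eq_T_mul_inv_mul_T (n : ℕ) : M n = T ℤ n * (U n)⁻¹ * T ℤ n := by
  rw [U, Matrix.mul_inv_rev, inv_rho_zeta, Matrix.mul_assoc, Matrix.mul_assoc,
    Matrix.nonsing_inv_mul _ (isUnit_det_T (R := ℤ) n), Matrix.mul_one, M]

/-- `det T ∈ {1, −1}`. [cite: LagariasMontague2015, §1] -/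
theorem det_T (n : ℕ) : (T ℤ n).det = 1 ∨ (T ℤ n).det = -1 :=
  Int.isUnit_iff.1 (isUnit_det_T n)

/-- `det 𝒰ₙ ∈ {1, −1}` ("consequently it has determinant `±1`").
[cite: LagariasMontague2015, §1] -/
theorem det_U (n : ℕ) : (U n).det = 1 ∨ (U n).det = -1 := by
  refine Int.isUnit_iff.1 ?_
  rw [U, Matrix.det_mul]
  refine (isUnit_det_T n).mul (IsUnit.of_mul_eq_one (rho n (μ : ArithmeticFunction ℤ)).det ?_)
  rw [← Matrix.det_mul, rho_zeta_mul_rho_moebius, Matrix.det_one]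

/-- `det ℳₙ ∈ {1, −1}` (`det ℳₙ = det 𝒰ₙ`). [cite: LagariasMontague2015, §1] -/
theorem det_M (n : ℕ) : (M n).det = 1 ∨ (M n).det = -1 := by
  refine Int.isUnit_iff.1 ?_
  rw [M, Matrix.det_mul]
  refine (isUnit_det_T n).mul (IsUnit.of_mul_eq_one (rho n (ζ : ArithmeticFunction ℤ)).det ?_)
  rw [← Matrix.det_mul, rho_moebius_mul_rho_zeta, Matrix.det_one]

/-- `M(n)` is the `(1,1)` entry of `ℳₙ` (first line of the proof of Theorem 12).
[cite: Cardinal2010, Theorem 12 (proof); LagariasMontague2015, Theorem 4.4 (proof)] -/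
theorem M_one_one {n : ℕ} (hn : 1 ≤ n) :
    M n ⟨1, one_mem hn⟩ ⟨1, one_mem hn⟩ = ∑ k ∈ Icc 1 n, μ k := by
  rw [M_apply]
  simp

/-- `ℳₙ(1,1) = M(n)` in the tree's vocabulary. [cite: Cardinal2010, Theorem 12 (proof)] -/
theorem M_one_one_eq_mertensFunction {n : ℕ} (hn : 1 ≤ n) :
    M n ⟨1, one_mem hn⟩ ⟨1, one_mem hn⟩ = LFunctions.mertensFunction (n : ℝ) := by
  rw [M_apply_eq_mertensFunction]
  simp

/-- `𝒰ₙ(1,1) = n`. [cite: LagariasMontague2015, Lemma 3.4] -/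
theorem U_one_one {n : ℕ} (hn : 1 ≤ n) : U n ⟨1, one_mem hn⟩ ⟨1, one_mem hn⟩ = n := by
  rw [U_apply]
  simp

/-! ## Finite-level sign structure: `T`, `𝒰ₙ`, `ℳₙ` are indefinite for `n ≥ 2` -/

/-- The quadratic form of `A` on a vector supported on two indices. [folklore] -/
private theorem dotProduct_mulVec_two {m : Type*} [Fintype m] [DecidableEq m] (A : Matrix m m ℤ)
    {i j : m} (hij : i ≠ j) (a b : ℤ) :
    (fun p => if p = i then a else if p = j then b else 0) ⬝ᵥ
        (A *ᵥ fun p => if p = i then a else if p = j then b else 0) =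
      a * a * A i i + a * b * A i j + b * a * A j i + b * b * A j j := by
  set v : m → ℤ := fun p => if p = i then a else if p = j then b else 0 with hv
  have hvi : v i = a := by simp [hv]
  have hvj : v j = b := by simp [hv, hij.symm]
  have hv0 : ∀ p, p ≠ i ∧ p ≠ j → v p = 0 := fun p hp => by simp [hv, hp.1, hp.2]
  have hw : ∀ p, (A *ᵥ v) p = A p i * a + A p j * b := by
    intro p
    show (∑ q, A p q * v q) = _
    rw [Fintype.sum_eq_add i j hij (fun q hq => by rw [hv0 q hq, mul_zero]), hvi, hvj]
  show (∑ p, v p * (A *ᵥ v) p) = _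
  rw [Fintype.sum_eq_add i j hij (fun q hq => by rw [hv0 q hq, zero_mul]), hvi, hvj, hw, hw]
  ring

/-- A symmetric integer matrix with a principal `2 × 2` block `[[c, e], [e, 0]]`, `e ≠ 0`, is
**indefinite**: its quadratic form takes both signs (`q(e_i + t e_j) = c + 2te`).  [folklore] -/
private theorem indefinite_of_isSymm {m : Type*} [Fintype m] [DecidableEq m] {A : Matrix m m ℤ}
    (hA : A.IsSymm) {i j : m} (hij : i ≠ j) (hjj : A j j = 0) (hij1 : A i j ≠ 0) :
    (∃ v : m → ℤ, v ⬝ᵥ (A *ᵥ v) < 0) ∧ (∃ v : m → ℤ, 0 < v ⬝ᵥ (A *ᵥ v)) := by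
  have hji : A j i = A i j := hA.apply i j
  have hsq : 1 ≤ A i j * A i j := by
    have h0 := Int.one_le_abs hij1
    have := one_le_mul_of_one_le_of_one_le h0 h0
    rwa [abs_mul_abs_self] at this
  have key : ∀ b : ℤ, (fun p => if p = i then (1 : ℤ) else if p = j then b else 0) ⬝ᵥ
      (A *ᵥ fun p => if p = i then (1 : ℤ) else if p = j then b else 0) = A i i + 2 * b * A i j := by
    intro b
    rw [dotProduct_mulVec_two A hij, hji, hjj]
    ring
  have hprod : |A i i| + 1 ≤ (|A i i| + 1) * (A i j * A i j) :=
    le_mul_of_one_le_right (by positivity) hsq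
  constructor
  · refine ⟨_, (key (-((|A i i| + 1) * A i j))).trans_lt ?_⟩
    nlinarith [le_abs_self (A i i), abs_nonneg (A i i)]
  · refine ⟨_, lt_of_lt_of_eq ?_ (key ((|A i i| + 1) * A i j)).symm⟩
    nlinarith [neg_abs_le (A i i), abs_nonneg (A i i)]

/-- A witness of a negative value of the quadratic form rules out positive semidefiniteness.
[folklore] -/
private theorem not_posSemidef_of_exists_neg {m : Type*} [Fintype m] {A : Matrix m m ℤ}
    (h : ∃ v : m → ℤ, v ⬝ᵥ (A *ᵥ v) < 0) : ¬ A.PosSemidef := by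
  rintro hA
  obtain ⟨v, hv⟩ := h
  have h2 := (Matrix.posSemidef_iff_dotProduct_mulVec.1 hA).2 v
  rw [star_trivial] at h2
  exact absurd hv (not_lt.2 h2)

/-- A witness of a positive value of the quadratic form of `A` rules out positive
semidefiniteness of `−A` (negative semidefiniteness of `A`). [folklore] -/
private theorem not_posSemidef_neg_of_exists_pos {m : Type*} [Fintype m] {A : Matrix m m ℤ}
    (h : ∃ v : m → ℤ, 0 < v ⬝ᵥ (A *ᵥ v)) : ¬ (-A).PosSemidef := by
  rintro hA
  obtain ⟨v, hv⟩ := h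
  have h2 := (Matrix.posSemidef_iff_dotProduct_mulVec.1 hA).2 v
  rw [star_trivial, Matrix.neg_mulVec, dotProduct_neg] at h2
  linarith

/-- The indices `1` and `n` of `𝒮ₙ` are distinct for `n ≥ 2`. [folklore] -/
private theorem one_ne_self {n : ℕ} (hn : 2 ≤ n) :
    (⟨1, one_mem (le_trans one_le_two hn)⟩ : approxDiv n) ≠
      ⟨n, self_mem (le_trans one_le_two hn)⟩ := by
  intro h
  have := congrArg Subtype.val h
  simp only at this
  omega

/-- **`T` is indefinite for every `n ≥ 2`** (principal block `[[1,1],[1,0]]` on `x = 1`, `y = n`).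
[cite: Cardinal2010, Definition 3] -/
theorem T_indefinite {n : ℕ} (hn : 2 ≤ n) :
    (∃ v : approxDiv n → ℤ, v ⬝ᵥ (T ℤ n *ᵥ v) < 0) ∧
      (∃ v : approxDiv n → ℤ, 0 < v ⬝ᵥ (T ℤ n *ᵥ v)) := by
  refine indefinite_of_isSymm (isSymm_T n) (one_ne_self hn) ?_ ?_
  · rw [T_apply, if_neg]
    show ¬ (n * n ≤ n)
    nlinarith
  · rw [T_apply, if_pos (show 1 * n ≤ n by omega)]
    exact one_ne_zero

/-- **`𝒰ₙ` is indefinite for every `n ≥ 2`** (`𝒰ₙ(n,n) = ⌊1/n⌋ = 0`, `𝒰ₙ(1,n) = 1`).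
[cite: Cardinal2010, Proposition 11; LagariasMontague2015, Lemma 3.4] -/
theorem U_indefinite {n : ℕ} (hn : 2 ≤ n) :
    (∃ v : approxDiv n → ℤ, v ⬝ᵥ (U n *ᵥ v) < 0) ∧
      (∃ v : approxDiv n → ℤ, 0 < v ⬝ᵥ (U n *ᵥ v)) := by
  refine indefinite_of_isSymm (isSymm_U n) (one_ne_self hn) ?_ ?_
  · rw [U_apply]
    show (((n / (n * n) : ℕ) : ℤ)) = 0
    rw [Nat.div_eq_of_lt (by nlinarith), Nat.cast_zero]
  · rw [U_apply]
    show (((n / (1 * n) : ℕ) : ℤ)) ≠ 0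
    rw [one_mul, Nat.div_self (by omega)]
    exact one_ne_zero

/-- **`ℳₙ` is indefinite for every `n ≥ 2`** (`ℳₙ(n,n) = M(0) = 0`, `ℳₙ(1,n) = M(1) = 1`).
[cite: Cardinal2010, Proposition 11; LagariasMontague2015, Theorem 4.3] -/
theorem M_indefinite {n : ℕ} (hn : 2 ≤ n) :
    (∃ v : approxDiv n → ℤ, v ⬝ᵥ (M n *ᵥ v) < 0) ∧
      (∃ v : approxDiv n → ℤ, 0 < v ⬝ᵥ (M n *ᵥ v)) := by
  refine indefinite_of_isSymm (isSymm_M n) (one_ne_self hn) ?_ ?_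
  · rw [M_apply]
    show ∑ k ∈ Icc 1 (n / (n * n)), μ k = 0
    rw [Nat.div_eq_of_lt (by nlinarith)]
    simp
  · rw [M_apply]
    show ∑ k ∈ Icc 1 (n / (1 * n)), μ k ≠ 0
    rw [one_mul, Nat.div_self (by omega)]
    simp

/-- `T` is not positive semidefinite (`n ≥ 2`). [cite: Cardinal2010, Definition 3] -/
theorem not_posSemidef_T {n : ℕ} (hn : 2 ≤ n) : ¬ (T ℤ n).PosSemidef :=
  not_posSemidef_of_exists_neg (T_indefinite hn).1

/-- `−T` is not positive semidefinite (`n ≥ 2`). [cite: Cardinal2010, Definition 3] -/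
theorem not_posSemidef_neg_T {n : ℕ} (hn : 2 ≤ n) : ¬ (-T ℤ n).PosSemidef :=
  not_posSemidef_neg_of_exists_pos (T_indefinite hn).2

/-- `𝒰ₙ` is not positive semidefinite (`n ≥ 2`). [cite: Cardinal2010, Proposition 11] -/
theorem not_posSemidef_U {n : ℕ} (hn : 2 ≤ n) : ¬ (U n).PosSemidef :=
  not_posSemidef_of_exists_neg (U_indefinite hn).1

/-- `−𝒰ₙ` is not positive semidefinite (`n ≥ 2`). [cite: Cardinal2010, Proposition 11] -/
theorem not_posSemidef_neg_U {n : ℕ} (hn : 2 ≤ n) : ¬ (-U n).PosSemidef :=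
  not_posSemidef_neg_of_exists_pos (U_indefinite hn).2

/-- `ℳₙ` is not positive semidefinite (`n ≥ 2`). [cite: Cardinal2010, Proposition 11] -/
theorem not_posSemidef_M {n : ℕ} (hn : 2 ≤ n) : ¬ (M n).PosSemidef :=
  not_posSemidef_of_exists_neg (M_indefinite hn).1

/-- `−ℳₙ` is not positive semidefinite (`n ≥ 2`). [cite: Cardinal2010, Proposition 11] -/
theorem not_posSemidef_neg_M {n : ℕ} (hn : 2 ≤ n) : ¬ (-M n).PosSemidef :=
  not_posSemidef_neg_of_exists_pos (M_indefinite hn).2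

/-! ## The antidiagonal `y = x̄`: entries `1` on it, `0` below it (appended 2026-08-20, v2) -/

/-- `⌊n/(x·x̄)⌋ = 1` for `x ∈ 𝒮ₙ` (`x x̄ ≤ n < x(x̄ + 1) ≤ 2 x x̄`).
[cite: LagariasMontague2015, Lemma 3.4 (remark: all antidiagonal entries of 𝒰ₙ are 1)] -/
theorem div_mul_bar {n : ℕ} (x : approxDiv n) : n / ((x : ℕ) * (n / (x : ℕ))) = 1 := by
  have hx := one_le_of_mem x.2
  have hq : 1 ≤ n / (x : ℕ) := Nat.div_pos (le_of_mem x.2) hx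
  have h1 : n < (x : ℕ) * (n / (x : ℕ) + 1) := Nat.lt_mul_div_succ n hx
  have h2 : (x : ℕ) * (n / (x : ℕ)) ≤ n := Nat.mul_div_le n x
  apply Nat.div_eq_of_lt_le
  · rw [one_mul]
    exact h2
  · nlinarith

/-- Below the antidiagonal the products exceed `n`: `x̄ < y ⇒ n < x y`.
[cite: LagariasMontague2015, §1 (entries below the antidiagonal)] -/
theorem lt_mul_of_bar_lt {n : ℕ} {x y : approxDiv n} (h : bar x < y) : n < (x : ℕ) * y := by
  have h' : n / (x : ℕ) < (y : ℕ) := h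
  calc n < (x : ℕ) * (n / (x : ℕ) + 1) := Nat.lt_mul_div_succ n (one_le_of_mem x.2)
    _ ≤ (x : ℕ) * y := Nat.mul_le_mul_left _ h'

/-- On or above the antidiagonal the products are `≤ n`: `y ≤ x̄ ⇒ x y ≤ n`.
[cite: Cardinal2010, Lemma 8 (proof)] -/
theorem mul_le_of_le_bar {n : ℕ} {x y : approxDiv n} (h : y ≤ bar x) : (x : ℕ) * y ≤ n := by
  have h' : (y : ℕ) ≤ n / (x : ℕ) := h
  calc (x : ℕ) * y ≤ (x : ℕ) * (n / (x : ℕ)) := Nat.mul_le_mul_left _ h'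
    _ ≤ n := Nat.mul_div_le n x

/-- `𝒰ₙ(x, x̄) = 1`: "such matrices take value `1` on the anti-diagonal".
[cite: LagariasMontague2015, §1 and Lemma 3.4] -/
theorem U_apply_bar {n : ℕ} (x : approxDiv n) : U n x (bar x) = 1 := by
  rw [U_apply, coe_bar, div_mul_bar, Nat.cast_one]

/-- `𝒰ₙ(x, y) = 0` below the antidiagonal (`y > x̄`). [cite: LagariasMontague2015, §1 and Lemma 3.4] -/
theorem U_apply_of_bar_lt {n : ℕ} {x y : approxDiv n} (h : bar x < y) : U n x y = 0 := by
  rw [U_apply, Nat.div_eq_of_lt (lt_mul_of_bar_lt h), Nat.cast_zero]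

/-- `𝒰ₙ(x, y) ≥ 1` on and above the antidiagonal ("all entries above the antidiagonal are
positive"). [cite: LagariasMontague2015, §1] -/
theorem U_apply_pos_of_le_bar {n : ℕ} {x y : approxDiv n} (h : y ≤ bar x) : 0 < U n x y := by
  rw [U_apply]
  exact_mod_cast Nat.div_pos (mul_le_of_le_bar h) (Nat.mul_pos (one_le_of_mem x.2) (one_le_of_mem y.2))

/-- `ℳₙ(x, x̄) = M(1) = 1`. [cite: LagariasMontague2015, Theorem 4.3 (remark on antidiagonal entries)] -/
theorem M_apply_bar {n : ℕ} (x : approxDiv n) : M n x (bar x) = 1 := by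
  rw [M_apply, coe_bar, div_mul_bar]
  simp

/-- `ℳₙ(x, y) = M(0) = 0` below the antidiagonal. [cite: LagariasMontague2015, §1 and Theorem 4.3] -/
theorem M_apply_of_bar_lt {n : ℕ} {x y : approxDiv n} (h : bar x < y) : M n x y = 0 := by
  rw [M_apply, Nat.div_eq_of_lt (lt_mul_of_bar_lt h)]
  simp

section Generators

variable (R : Type*) [CommRing R]

/-- `T(x, y) = 1` on and above the antidiagonal. [cite: Cardinal2010, Definition 3] -/
theorem T_apply_of_le_bar {n : ℕ} {x y : approxDiv n} (h : y ≤ bar x) : T R n x y = 1 :=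
  if_pos (mul_le_of_le_bar h)

/-- `T(x, y) = 0` strictly below the antidiagonal. [cite: Cardinal2010, Definition 3] -/
theorem T_apply_of_bar_lt {n : ℕ} {x y : approxDiv n} (h : bar x < y) : T R n x y = 0 :=
  if_neg (not_le.2 (lt_mul_of_bar_lt h))

/-! ## The generators `ρₙ(k)` (Cardinal's `ρ(𝐤)`; Lagarias–Montague Theorem 2.4) -/

/-- **The generator `ρₙ(k)`** ("multiplication by `k` on approximate divisors"): column `y` has a
single `1` in the row `x ∈ 𝒮ₙ` with `⌊n/x⌋ = ⌊n/(yk)⌋`, and is zero if `y k > n`.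
[cite: Cardinal2010, §2.4 and Lemma 8 (proof); LagariasMontague2015, Theorem 2.4] -/
def rhoGen (n k : ℕ) : Matrix (approxDiv n) (approxDiv n) R :=
  Matrix.of fun x y => if n / ((y : ℕ) * k) = n / (x : ℕ) then (1 : R) else 0

variable {R}

/-- Entry formula for `rhoGen`. [cite: Cardinal2010, §2.4] -/
theorem rhoGen_apply {n : ℕ} (k : ℕ) (x y : approxDiv n) :
    rhoGen R n k x y = if n / ((y : ℕ) * k) = n / (x : ℕ) then (1 : R) else 0 := rfl

/-- `ρₙ(f) = ∑_{k ≤ n} f(k) ρₙ(k)` — Cardinal's `π̄(a) = ∑_{k ∈ 𝒮} (∑_{κ ∈ k̂} a_κ) 𝐤` followed by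
`ρ`; Lagarias–Montague's `ρ̃ₙ(∑ a_k k^{-s}) = ∑_{m ∈ 𝒮ₙ} (∑_{m⁻ < k ≤ m} a_k) ρₙ(m)` (the inner
grouping is automatic here since `ρₙ(k) = ρₙ(m)` for `k` in the class of `m`).
[cite: Cardinal2010, Proposition 6; LagariasMontague2015, Theorem 2.7] -/
theorem rho_eq_sum_smul_rhoGen {n : ℕ} (f : ArithmeticFunction R) :
    rho n f = ∑ k ∈ Icc 1 n, f k • rhoGen R n k := by
  ext x y
  rw [rho_apply, Matrix.sum_apply]
  refine Finset.sum_congr rfl fun k _ => ?_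
  rw [Matrix.smul_apply, rhoGen_apply, smul_eq_mul, mul_ite, mul_one, mul_zero]

/-- `ρₙ(k) = ρₙ(m)` when `k ~ m` (`⌊n/k⌋ = ⌊n/m⌋`): the representation only sees classes.
[cite: Cardinal2010, Proposition 3 and §2.4] -/
theorem rhoGen_congr {n k m : ℕ} (h : n / k = n / m) : rhoGen R n k = rhoGen R n m := by
  ext x y
  rw [rhoGen_apply, rhoGen_apply, mul_comm (y : ℕ) k, mul_comm (y : ℕ) m, ← Nat.div_div_eq_div_mul,
    h, Nat.div_div_eq_div_mul]

/-- `ρₙ(1) = 1` ("the matrix `ρ(1)` is the identity matrix").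
[cite: Cardinal2010, §2.4; LagariasMontague2015, Theorem 2.4] -/
theorem rhoGen_one (n : ℕ) : rhoGen R n 1 = 1 := by
  ext x y
  rw [rhoGen_apply, mul_one, Matrix.one_apply]
  by_cases hxy : x = y
  · subst hxy
    simp
  · rw [if_neg hxy, if_neg]
    intro h
    exact hxy (Subtype.ext (eq_of_div_eq_div x.2 y.2 h.symm))

/-- `ρₙ(k) = 0` for `k > n` (the class `∞̂` is sent to `𝟎` in the quotient algebra `𝒜̄`).
[cite: Cardinal2010, §2.2.2 (`ϖ(∞̂) = 𝟎`)] -/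
theorem rhoGen_eq_zero_of_lt {n k : ℕ} (hk : n < k) : rhoGen R n k = 0 := by
  ext x y
  rw [rhoGen_apply, Matrix.zero_apply, if_neg]
  rw [Nat.div_eq_of_lt (lt_of_lt_of_le hk (Nat.le_mul_of_pos_left k (one_le_of_mem y.2)))]
  exact (Nat.ne_of_gt (Nat.div_pos (le_of_mem x.2) (one_le_of_mem x.2))).symm

/-- **Multiplicativity of the generators**: `ρₙ(k) ρₙ(l) = ρₙ(k l)` (`e_k ⋆ e_l = e_{kl}`, `k̂ l̂ = k̂l`,
and `ρ` is a representation). [cite: Cardinal2010, Properties 4, Proposition 3 and Proposition 5;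
LagariasMontague2015, Theorem 2.4] -/
theorem rhoGen_mul {n k l : ℕ} (hk : 1 ≤ k) (hl : 1 ≤ l) :
    rhoGen R n k * rhoGen R n l = rhoGen R n (k * l) := by
  ext x y
  rw [Matrix.mul_apply, rhoGen_apply]
  simp_rw [rhoGen_apply]
  have h := sum_rho_mul_rho_aux x y hk hl (1 : R) 1
  rw [mul_one] at h
  exact h

/-- The generators commute ("this algebra is commutative").
[cite: Cardinal2010, §2.4; LagariasMontague2015, Theorem 2.4] -/
theorem rhoGen_comm {n k l : ℕ} (hk : 1 ≤ k) (hl : 1 ≤ l) :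
    rhoGen R n k * rhoGen R n l = rhoGen R n l * rhoGen R n k := by
  rw [rhoGen_mul hk hl, rhoGen_mul hl hk, mul_comm]

/-- Powers: `ρₙ(k)^t = ρₙ(k^t)`. [cite: LagariasMontague2015, Theorem 2.4] -/
theorem rhoGen_pow {n k : ℕ} (hk : 1 ≤ k) (t : ℕ) : rhoGen R n k ^ t = rhoGen R n (k ^ t) := by
  induction t with
  | zero => rw [pow_zero, pow_zero, rhoGen_one]
  | succ t ih => rw [pow_succ, ih, rhoGen_mul (Nat.one_le_pow _ _ hk) hk, pow_succ]

/-- **`ρₙ(k)` is nilpotent for `k ≥ 2`** (`ρₙ(k)^n = ρₙ(k^n) = 0` as `k^n > n`): "all other `ρₙ(k)`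
are lower triangular nilpotent".  [cite: LagariasMontague2015, Theorem 2.4 and Remark 2.6] -/
theorem rhoGen_pow_self_eq_zero {n k : ℕ} (hk : 2 ≤ k) : rhoGen R n k ^ n = 0 := by
  rw [rhoGen_pow (le_trans one_le_two hk)]
  exact rhoGen_eq_zero_of_lt (lt_of_lt_of_le n.lt_two_pow_self (Nat.pow_le_pow_left hk n))

/-- `ρₙ(k)` is nilpotent for `k ≥ 2`. [cite: LagariasMontague2015, Theorem 2.4 and Remark 2.6] -/
theorem isNilpotent_rhoGen {n k : ℕ} (hk : 2 ≤ k) : IsNilpotent (rhoGen R n k) :=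
  ⟨n, rhoGen_pow_self_eq_zero hk⟩

/-- **`ρₙ(k)` is lower triangular** (rows and columns in increasing order): `ρₙ(k)_{x,y} = 0` for
`x < y`, since `⌊n/(yk)⌋ ≤ ⌊n/y⌋ < ⌊n/x⌋`. [cite: LagariasMontague2015, Theorem 2.4] -/
theorem rhoGen_apply_eq_zero_of_lt {n k : ℕ} (hk : 1 ≤ k) {x y : approxDiv n} (h : x < y) :
    rhoGen R n k x y = 0 := by
  rw [rhoGen_apply, if_neg]
  intro heq
  have h1 : n / ((y : ℕ) * k) ≤ n / (y : ℕ) :=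
    Nat.div_le_div_left (Nat.le_mul_of_pos_right _ hk) (one_le_of_mem y.2)
  have h2 : n / (y : ℕ) < n / (x : ℕ) := bar_lt_bar h
  omega

/-- `ρₙ(k)` is (block) lower triangular in Mathlib's sense. [cite: LagariasMontague2015, Theorem 2.4] -/
theorem rhoGen_blockTriangular {n k : ℕ} (hk : 1 ≤ k) :
    (rhoGen R n k).BlockTriangular OrderDual.toDual := fun _ _ hxy =>
  rhoGen_apply_eq_zero_of_lt hk (OrderDual.toDual_lt_toDual.1 hxy)

/-- `tr ρₙ(k) = 0` for `2 ≤ k` (no fixed classes: `⌊n/(xk)⌋ < ⌊n/x⌋`); `tr ρₙ(1) = #𝒮ₙ`.  This is the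
"(i) FAIL (T = 0)" mechanism of the census item: every trace the checker can form from the
generators vanishes. [cite: LagariasMontague2015, Theorem 2.4 and Remark 2.6] -/
theorem trace_rhoGen_eq_zero {n k : ℕ} (hk : 2 ≤ k) : (rhoGen R n k).trace = 0 := by
  refine Finset.sum_eq_zero fun x _ => ?_
  rw [Matrix.diag_apply, rhoGen_apply, if_neg]
  intro heq
  have hx := one_le_of_mem x.2
  have h1 : n / ((x : ℕ) * k) < n / (x : ℕ) := by
    rw [← Nat.div_div_eq_div_mul]
    exact Nat.div_lt_self (Nat.div_pos (le_of_mem x.2) hx) hk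
  omega

variable (R) in
/-- The arithmetic function `e_k` (`k ≥ 1`): indicator of `{k}`. [folklore] -/
private def ind (k : ℕ) (hk : 1 ≤ k) : ArithmeticFunction R :=
  ⟨fun m => if m = k then 1 else 0, if_neg (by omega)⟩

/-- Values of `e_k`. [folklore] -/
private theorem ind_apply {k : ℕ} (hk : 1 ≤ k) (m : ℕ) :
    ind R k hk m = if m = k then (1 : R) else 0 := rfl

/-- `ρₙ(e_k) = ρₙ(k)` for `1 ≤ k ≤ n`. [cite: Cardinal2010, Definition 2 (`ϑ(e_i) = î`) and §2.4] -/
private theorem rho_ind {n k : ℕ} (hk : 1 ≤ k) (hkn : k ≤ n) : rho n (ind R k hk) = rhoGen R n k := by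
  ext x y
  rw [rho_apply, rhoGen_apply, Finset.sum_eq_single_of_mem k (Finset.mem_Icc.2 ⟨hk, hkn⟩)]
  · rw [ind_apply, if_pos rfl]
  · intro m _ hm
    rw [ind_apply, if_neg hm, ite_self]

/-- **Lemma 8** as printed: `(T ρₙ(k))_{x,y} = 1` if `k ≤ ⌊n/(xy)⌋` (`⇔ x y ≤ ⌊n/k⌋ ⇔ x y k ≤ n`),
and `0` otherwise. [cite: Cardinal2010, Lemma 8] -/
theorem T_mul_rhoGen_apply {n k : ℕ} (hk : 1 ≤ k) (x y : approxDiv n) :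
    (T R n * rhoGen R n k) x y = if k ≤ n / ((x : ℕ) * y) then (1 : R) else 0 := by
  by_cases hkn : k ≤ n
  · rw [← rho_ind hk hkn, T_mul_rho_apply]
    simp_rw [ind_apply]
    rw [Finset.sum_ite_eq']
    simp [Finset.mem_Icc, hk]
  · rw [rhoGen_eq_zero_of_lt (lt_of_not_ge hkn), Matrix.mul_zero, Matrix.zero_apply, if_neg]
    exact fun h => hkn (h.trans (Nat.div_le_self _ _))

/-- The two printed reformulations of the condition in Lemma 8: `x y ≤ ⌊n/k⌋ ⇔ k ≤ ⌊n/(xy)⌋`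
(both say `x y k ≤ n`). [cite: Cardinal2010, Lemma 8] -/
theorem mul_le_div_iff_le_div_mul {n k x y : ℕ} (hk : 1 ≤ k) (hxy : 1 ≤ x * y) :
    x * y ≤ n / k ↔ k ≤ n / (x * y) := by
  rw [Nat.le_div_iff_mul_le hk, Nat.le_div_iff_mul_le hxy, mul_comm]

end Generators

/-! ## `𝒮ₙ = 𝒮ₙ⁻ ∪ 𝒮ₙ⁺` and `#𝒮ₙ` (Cardinal Proposition 1; Lagarias–Montague Definition 2.1) -/

/-- `𝒮ₙ⁻ ⊆ 𝒮ₙ`: every `1 ≤ x ≤ ⌊√n⌋` is an approximate divisor (the classes below `√n` are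
singletons). [cite: Cardinal2010, Proposition 1 (proof); LagariasMontague2015, Definition 2.1] -/
theorem mem_of_le_sqrt {n x : ℕ} (h1 : 1 ≤ x) (hx : x ≤ Nat.sqrt n) : x ∈ approxDiv n := by
  have hxx : x * x ≤ n := Nat.le_sqrt.1 hx
  have hxn : x ≤ n := le_trans (Nat.le_mul_of_pos_left x h1) hxx
  have hq : x ≤ n / x := (Nat.le_div_iff_mul_le h1).2 hxx
  refine mem_approxDiv_iff.2 ⟨h1, hxn, ?_⟩
  have h2 : n < x * (n / x + 1) := Nat.lt_mul_div_succ n h1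
  apply Nat.div_eq_of_lt_le
  · exact Nat.mul_div_le n x
  · nlinarith

/-- `k ↦ ⌊n/k⌋` is injective on `1 ≤ k ≤ ⌊√n⌋` (so `#𝒮ₙ⁺ = ⌊√n⌋`).
[cite: Cardinal2010, Proposition 1; LagariasMontague2015, Definition 2.1] -/
theorem div_injOn_Icc_sqrt (n : ℕ) : Set.InjOn (fun k => n / k) (Icc 1 (Nat.sqrt n) : Finset ℕ) := by
  -- if `k₁ < k₂ ≤ √n` had the same quotient `q`, then `k₂ ≤ q` and `k₂ q ≤ n < k₁ (q + 1)` give `q < k₁`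
  have key : ∀ k₁ k₂ : ℕ, k₁ ∈ (Icc 1 (Nat.sqrt n) : Finset ℕ) → k₂ ∈ (Icc 1 (Nat.sqrt n) : Finset ℕ) →
      k₁ < k₂ → n / k₁ ≠ n / k₂ := by
    intro k₁ k₂ hk₁ hk₂ hlt heq
    rw [Finset.mem_Icc] at hk₁ hk₂
    have hq : k₂ ≤ n / k₂ := (Nat.le_div_iff_mul_le hk₂.1).2 (Nat.le_sqrt.1 hk₂.2)
    have h1 : n < k₁ * (n / k₁ + 1) := Nat.lt_mul_div_succ n hk₁.1
    have h2 : k₂ * (n / k₂) ≤ n := Nat.mul_div_le n k₂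
    rw [heq] at h1
    nlinarith
  intro k₁ hk₁ k₂ hk₂ heq
  rcases lt_trichotomy k₁ k₂ with h | h | h
  · exact absurd heq (key k₁ k₂ hk₁ hk₂ h)
  · exact h
  · exact absurd heq.symm (key k₂ k₁ hk₂ hk₁ h)

/-- **`𝒮ₙ = 𝒮ₙ⁻ ∪ 𝒮ₙ⁺`** with `𝒮ₙ⁻ = {1, …, ⌊√n⌋}` and `𝒮ₙ⁺ = {⌊n/j⌋ : 1 ≤ j ≤ ⌊√n⌋}`.
[cite: Cardinal2010, Proposition 1; LagariasMontague2015, Definition 2.1] -/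
theorem approxDiv_eq_union (n : ℕ) :
    approxDiv n = Icc 1 (Nat.sqrt n) ∪ (Icc 1 (Nat.sqrt n)).image fun j => n / j := by
  ext x
  rw [Finset.mem_union, Finset.mem_image]
  constructor
  · intro hx
    obtain ⟨k, ⟨hk1, hkn⟩, rfl⟩ := mem_approxDiv.1 hx
    by_cases hk : k ≤ Nat.sqrt n
    · exact Or.inr ⟨k, Finset.mem_Icc.2 ⟨hk1, hk⟩, rfl⟩
    · refine Or.inl (Finset.mem_Icc.2 ⟨Nat.div_pos hkn hk1, ?_⟩)
      have h1 : n / k ≤ n / (Nat.sqrt n + 1) := Nat.div_le_div_left (by omega) (Nat.succ_pos _)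
      have h2 : n / (Nat.sqrt n + 1) < Nat.sqrt n + 1 :=
        (Nat.div_lt_iff_lt_mul (Nat.succ_pos _)).2 (Nat.lt_succ_sqrt n)
      omega
  · rintro (hx | ⟨j, hj, rfl⟩)
    · exact mem_of_le_sqrt (Finset.mem_Icc.1 hx).1 (Finset.mem_Icc.1 hx).2
    · exact div_mem_approxDiv (Finset.mem_Icc.1 hj).1
        (le_trans (Finset.mem_Icc.1 hj).2 (Nat.sqrt_le_self n))

/-- `𝒮ₙ⁻ ∩ 𝒮ₙ⁺ ⊆ {⌊√n⌋}`, with equality iff `⌊n/⌊√n⌋⌋ = ⌊√n⌋`, i.e. iff `n < ⌊√n⌋(⌊√n⌋ + 1)`.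
[cite: Cardinal2010, Proposition 1; LagariasMontague2015, Definition 2.1] -/
theorem inter_eq (n : ℕ) :
    Icc 1 (Nat.sqrt n) ∩ (Icc 1 (Nat.sqrt n)).image (fun j => n / j) =
      if n < Nat.sqrt n * (Nat.sqrt n + 1) then {Nat.sqrt n} else ∅ := by
  set a := Nat.sqrt n with ha
  have haa : a * a ≤ n := Nat.sqrt_le n
  ext x
  rw [Finset.mem_inter, Finset.mem_Icc, Finset.mem_image]
  constructor
  · rintro ⟨⟨hx1, hxa⟩, ⟨j, hj, rfl⟩⟩
    rw [Finset.mem_Icc] at hj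
    -- `n / j ≥ n / a ≥ a` and `n / j ≤ a` force `n / j = a` and `j`'s quotient class is that of `a`
    have ha1 : 1 ≤ a := le_trans hj.1 hj.2
    have h1 : a ≤ n / a := (Nat.le_div_iff_mul_le ha1).2 haa
    have h2 : n / a ≤ n / j := Nat.div_le_div_left hj.2 hj.1
    have hxa' : n / j = a := le_antisymm hxa (h1.trans h2)
    have hna : n / a = a := le_antisymm (le_of_le_of_eq h2 hxa') h1
    have hlt : n < a * (a + 1) := by
      have := Nat.lt_mul_div_succ n ha1
      rwa [hna] at this
    rw [if_pos hlt, Finset.mem_singleton, hxa']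
  · intro hx
    split_ifs at hx with hlt
    · rw [Finset.mem_singleton] at hx
      subst hx
      have ha1 : 1 ≤ a := by
        rcases Nat.eq_zero_or_pos a with h0 | h0
        · rw [h0] at hlt; simp at hlt
        · exact h0
      refine ⟨⟨ha1, le_rfl⟩, a, Finset.mem_Icc.2 ⟨ha1, le_rfl⟩, ?_⟩
      exact Nat.div_eq_of_lt_le haa (by rw [mul_comm] at hlt; exact hlt)
    · simp at hx

/-- **Cardinal's count** `#𝒮ₙ = 2⌊√n⌋ − 1` if `n < ⌊√n⌋² + ⌊√n⌋` and `= 2⌊√n⌋` otherwise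
(equivalently `#𝒮ₙ = ⌊√n⌋ + ⌊√(n + ¼) − ½⌋`; Lagarias–Montague: `s(n) = 2⌊√n⌋` or `2⌊√n⌋ − 1`).
[cite: Cardinal2010, Proposition 1; LagariasMontague2015, Definition 2.1] -/
theorem card_approxDiv (n : ℕ) :
    (approxDiv n).card =
      2 * Nat.sqrt n - (if n < Nat.sqrt n * (Nat.sqrt n + 1) then 1 else 0) := by
  have hunion := Finset.card_union_add_card_inter (Icc 1 (Nat.sqrt n))
    ((Icc 1 (Nat.sqrt n)).image fun j => n / j)
  rw [← approxDiv_eq_union, inter_eq, Nat.card_Icc,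
    Finset.card_image_of_injOn (div_injOn_Icc_sqrt n), Nat.card_Icc] at hunion
  split_ifs at hunion ⊢ with hlt
  · rw [Finset.card_singleton] at hunion
    omega
  · rw [Finset.card_empty] at hunion
    omega

/-! ## The exact sign structure of `T` (appended 2026-08-20, v3)

`T = E P` with `E_{x,z} = [x ≤ z]` and `P` the permutation matrix of the involution `z ↦ z̄`, so
`wᵀ T w = ∑_{x ≤ z} w(x) w(z̄)`; on the `(+1)`-eigenspace of `w ↦ w ∘ bar` (dimension
`#{x ∈ 𝒮ₙ : x ≤ x̄} = ⌈s/2⌉`) this is `½((∑w)² + ∑w²) > 0`, on the `(−1)`-eigenspace (dimension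
`#{x : x < x̄} = ⌊s/2⌋`, where `∑ w = 0`) it is `−½ ∑ w² < 0`.  By Sylvester's law of inertia the
inertia of `T` is therefore exactly `(⌈s/2⌉, 0, ⌊s/2⌋)`, `s = #𝒮ₙ` — the triple the census
pre-registers for the `T`-cells of `t9-cardinal-forms-01` (the `𝒰ₙ`, `ℳₙ` cells carry the same
triple at every served `n`: `𝒰ₙ = T(1 + N)`, `ℳₙ = T(1 + N)⁻¹` with `N = ρₙ(u) − 1` nilpotent, and
`t ↦ T(1 + tN)` is a path of symmetric unimodular matrices; that continuity argument is not
formalised here).  Sylvester's law itself is not invoked: the file proves the two definiteness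
statements and the counting identity `2·#{x < x̄} + #{x = x̄} = s`, `#{x = x̄} ≤ 1`. -/

section SignStructure

/-- `wᵀ T w = ∑_{x ≤ z} w(x) w(z̄)` (substitute `y = z̄`: `x y ≤ n ⇔ x ≤ z`).
[cite: Cardinal2010, Definition 3 and Proposition 1] -/
theorem dotProduct_T_mulVec {n : ℕ} (w : approxDiv n → ℤ) :
    w ⬝ᵥ (T ℤ n *ᵥ w) = ∑ x, ∑ z, if x ≤ z then w x * w (bar z) else 0 := by
  simp only [dotProduct, Matrix.mulVec, T_apply]
  refine Finset.sum_congr rfl fun x _ => ?_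
  rw [Finset.mul_sum,
    ← Equiv.sum_comp (barEquiv n) (fun y => w x * ((if (x : ℕ) * y ≤ n then (1 : ℤ) else 0) * w y))]
  refine Finset.sum_congr rfl fun z _ => ?_
  have h := mul_le_iff_le_bar (bar z) (x : ℕ)
  rw [bar_bar, coe_bar] at h
  simp only [barEquiv_apply, coe_bar]
  by_cases hxz : x ≤ z
  · rw [if_pos (h.2 hxz), if_pos hxz, one_mul]
  · rw [if_neg (fun h' => hxz (h.1 h')), if_neg hxz, zero_mul, mul_zero]

/-- `2 ∑_{x ≤ z} u(x) u(z) = (∑ u)² + ∑ u²` on a finite linear order. [folklore] -/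
private theorem two_mul_sum_sum_le {ι : Type*} [Fintype ι] [LinearOrder ι] (u : ι → ℤ) :
    2 * (∑ x, ∑ z, if x ≤ z then u x * u z else 0) = (∑ x, u x) ^ 2 + ∑ x, u x ^ 2 := by
  have hD : (∑ x, ∑ z, if x ≤ z then u x * u z else (0 : ℤ)) =
      ∑ x, ∑ z, if z ≤ x then u x * u z else 0 := by
    rw [Finset.sum_comm]
    refine Finset.sum_congr rfl fun x _ => Finset.sum_congr rfl fun z _ => ?_
    split_ifs <;> ring
  have hsq : ∀ x : ι, u x ^ 2 = ∑ z, if z = x then u x * u z else 0 := by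
    intro x
    rw [Finset.sum_ite_eq' Finset.univ x, if_pos (Finset.mem_univ x), sq]
  rw [two_mul]
  nth_rewrite 2 [hD]
  rw [sq, Finset.sum_mul_sum, ← Finset.sum_add_distrib, ← Finset.sum_add_distrib]
  refine Finset.sum_congr rfl fun x _ => ?_
  rw [hsq x, ← Finset.sum_add_distrib, ← Finset.sum_add_distrib]
  refine Finset.sum_congr rfl fun z _ => ?_
  rcases lt_trichotomy x z with h | h | h
  · simp [h.le, not_le.2 h, ne_of_gt h]
  · subst h
    simp
  · simp [not_le.2 h, h.le, ne_of_lt h]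

/-- A `bar`-anti-invariant function sums to zero (pairs cancel; at a fixed point `w = −w = 0`).
[cite: Cardinal2010, Proposition 1 (the involution)] -/
theorem sum_eq_zero_of_antiinvariant {n : ℕ} (w : approxDiv n → ℤ) (hw : ∀ z, w (bar z) = -w z) :
    ∑ z, w z = 0 := by
  have h := Equiv.sum_comp (barEquiv n) w
  simp only [barEquiv_apply, hw, Finset.sum_neg_distrib] at h
  linarith

/-- **`T` on `bar`-invariant functions**: `2 wᵀTw = (∑ w)² + ∑ w²`.
[cite: Cardinal2010, Definition 3 and Proposition 1] -/
theorem two_mul_form_T_of_invariant {n : ℕ} (w : approxDiv n → ℤ) (hw : ∀ z, w (bar z) = w z) :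
    2 * (w ⬝ᵥ (T ℤ n *ᵥ w)) = (∑ z, w z) ^ 2 + ∑ z, w z ^ 2 := by
  rw [dotProduct_T_mulVec]
  simp_rw [hw]
  exact two_mul_sum_sum_le w

/-- **`T` on `bar`-anti-invariant functions**: `2 wᵀTw = −∑ w²`.
[cite: Cardinal2010, Definition 3 and Proposition 1] -/
theorem two_mul_form_T_of_antiinvariant {n : ℕ} (w : approxDiv n → ℤ)
    (hw : ∀ z, w (bar z) = -w z) : 2 * (w ⬝ᵥ (T ℤ n *ᵥ w)) = -∑ z, w z ^ 2 := by
  rw [dotProduct_T_mulVec]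
  simp_rw [hw]
  have h : (∑ x, ∑ z, if x ≤ z then w x * -w z else (0 : ℤ)) =
      -(∑ x, ∑ z, if x ≤ z then w x * w z else 0) := by
    rw [← Finset.sum_neg_distrib]
    refine Finset.sum_congr rfl fun x _ => ?_
    rw [← Finset.sum_neg_distrib]
    refine Finset.sum_congr rfl fun z _ => ?_
    split_ifs <;> ring
  rw [h, mul_neg, two_mul_sum_sum_le, sum_eq_zero_of_antiinvariant w hw]
  ring

/-- A nonzero integer vector has positive sum of squares. [folklore] -/
private theorem sum_sq_pos {ι : Type*} [Fintype ι] {w : ι → ℤ} (h0 : w ≠ 0) : 0 < ∑ z, w z ^ 2 := by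
  obtain ⟨z, hz⟩ := Function.ne_iff.1 h0
  have hz' : w z ≠ 0 := hz
  exact lt_of_lt_of_le (sq_pos_iff.2 hz')
    (Finset.single_le_sum (fun i _ => sq_nonneg (w i)) (Finset.mem_univ z))

/-- **`T` is positive definite on the `bar`-invariant functions** (a space of dimension
`#{x ∈ 𝒮ₙ : x ≤ x̄} = ⌈s/2⌉`). [cite: Cardinal2010, Definition 3 and Proposition 1] -/
theorem form_T_pos_of_invariant {n : ℕ} {w : approxDiv n → ℤ} (hw : ∀ z, w (bar z) = w z)
    (h0 : w ≠ 0) : 0 < w ⬝ᵥ (T ℤ n *ᵥ w) := by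
  have h := two_mul_form_T_of_invariant w hw
  have hpos := sum_sq_pos h0
  nlinarith [sq_nonneg (∑ z, w z)]

/-- **`T` is negative definite on the `bar`-anti-invariant functions** (a space of dimension
`#{x ∈ 𝒮ₙ : x < x̄} = ⌊s/2⌋`). [cite: Cardinal2010, Definition 3 and Proposition 1] -/
theorem form_T_neg_of_antiinvariant {n : ℕ} {w : approxDiv n → ℤ} (hw : ∀ z, w (bar z) = -w z)
    (h0 : w ≠ 0) : w ⬝ᵥ (T ℤ n *ᵥ w) < 0 := by
  have h := two_mul_form_T_of_antiinvariant w hw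
  have hpos := sum_sq_pos h0
  linarith

/-- A fixed point of the involution is `⌊√n⌋` (`x = ⌊n/x⌋ ⇔ x² ≤ n < x(x+1)`), so there is at most
one. [cite: Cardinal2010, Proposition 1 (`[√n] = [√n]‾ ⇔ n < k² + k`)] -/
theorem coe_eq_sqrt_of_bar_eq {n : ℕ} {x : approxDiv n} (h : bar x = x) : (x : ℕ) = Nat.sqrt n := by
  have h' : n / (x : ℕ) = x := congrArg Subtype.val h
  have h1 : (x : ℕ) * (n / (x : ℕ)) ≤ n := Nat.mul_div_le n x
  have h2 : n < (x : ℕ) * (n / (x : ℕ) + 1) := Nat.lt_mul_div_succ n (one_le_of_mem x.2)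
  rw [h'] at h1 h2
  rw [Nat.eq_sqrt]
  constructor
  · exact h1
  · nlinarith

/-- The involution has at most one fixed point. [cite: Cardinal2010, Proposition 1] -/
theorem card_fixed_le_one (n : ℕ) :
    (Finset.univ.filter fun x : approxDiv n => bar x = x).card ≤ 1 := by
  rw [Finset.card_le_one]
  intro x hx y hy
  rw [Finset.mem_filter] at hx hy
  exact Subtype.ext ((coe_eq_sqrt_of_bar_eq hx.2).trans (coe_eq_sqrt_of_bar_eq hy.2).symm)

/-- `bar` maps `{x : x < x̄}` onto `{y : ȳ < y}`. [cite: Cardinal2010, Proposition 1] -/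
theorem image_bar_filter_lt (n : ℕ) :
    (Finset.univ.filter fun x : approxDiv n => x < bar x).image bar =
      Finset.univ.filter fun y : approxDiv n => bar y < y := by
  ext y
  simp only [Finset.mem_image, Finset.mem_filter, Finset.mem_univ, true_and]
  constructor
  · rintro ⟨x, hx, rfl⟩
    rwa [bar_bar]
  · intro hy
    exact ⟨bar y, by rwa [bar_bar], bar_bar y⟩

/-- **Counting**: `2·#{x : x < x̄} + #{x : x = x̄} = #𝒮ₙ`; with `card_fixed_le_one` this says
`#{x : x ≤ x̄} = ⌈s/2⌉` and `#{x : x < x̄} = ⌊s/2⌋` — the dimensions of the `±`-eigenspaces of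
`w ↦ w ∘ bar` on which `T` is definite (`form_T_pos_of_invariant`, `form_T_neg_of_antiinvariant`),
i.e. by Sylvester's law of inertia the inertia of `T` is `(⌈s/2⌉, 0, ⌊s/2⌋)`.
[cite: Cardinal2010, Proposition 1 and Definition 3] -/
theorem two_mul_card_lt_bar_add_card_fixed (n : ℕ) :
    2 * (Finset.univ.filter fun x : approxDiv n => x < bar x).card +
        (Finset.univ.filter fun x : approxDiv n => bar x = x).card = (approxDiv n).card := by
  have hgt : (Finset.univ.filter fun y : approxDiv n => bar y < y).card =
      (Finset.univ.filter fun x : approxDiv n => x < bar x).card := by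
    rw [← image_bar_filter_lt, Finset.card_image_of_injective _ (bar_involutive n).injective]
  have htot : (Finset.univ.filter fun x : approxDiv n => x < bar x).card +
      (Finset.univ.filter fun x : approxDiv n => bar x = x).card +
      (Finset.univ.filter fun y : approxDiv n => bar y < y).card = (Finset.univ : Finset (approxDiv n)).card := by
    rw [Finset.card_filter, Finset.card_filter, Finset.card_filter, ← Finset.sum_add_distrib,
      ← Finset.sum_add_distrib, Finset.card_eq_sum_ones]
    refine Finset.sum_congr rfl fun x _ => ?_
    rcases lt_trichotomy x (bar x) with h | h | h
    · rw [if_pos h, if_neg (ne_of_gt h), if_neg (not_lt.2 h.le)]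
    · rw [if_neg (by rw [← h]; exact lt_irrefl _), if_pos h.symm, if_neg (by rw [← h]; exact lt_irrefl _)]
    · rw [if_neg (not_lt.2 h.le), if_neg (ne_of_lt h), if_pos h]
  rw [Finset.card_univ, Fintype.card_coe] at htot
  omega

end SignStructure

end Cardinal2010

end Literature.NumberTheory.Multiplicative
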